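import Summits.BirchSwinnertonDyer.Rank1Residual.GaloisImage.KolyvaginDerivativeDescent
import HarnessLib

/-!
# (C3) mechanism, kernel glue (G): cochain normal forms feeding Lemma C — exact restriction
# `k|_U = red ∘ x̃` and the exact obstruction identity `g⋆x̃ − x̃ − ∂(k̃ g) = M·ỹ_g`
# (cell `bsd-addord`, seat bsd-addord-w2-acc5 gen 0; crux `KatoKuriharaPortThreeShared` =
# stmt-BirchSwinnertonDyer-19560, residual input (C3) = THEOREM D's `hbad`; `--supports 19560`)

## Why (memo HOME/acc5/ACC5-C3-MECHANISM-g0.md §1 and §6 item K-G)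

Lemma C (`KimAtThreePortSharedC3Descent.exists_cohomologyMap_eq_oneCocycleClass_of_correction`,
p469494) consumes COCHAIN-level data: a cocycle `k` of `κ_r` and a cocycle `x̃` of `X̃ = D_r c_r` with
`k|_U = red ∘ x̃` on the nose, and obstruction cocycles `ỹ_g` with `g⋆x̃ − x̃ − ∂(k̃ g) = M·ỹ_g` exactly.
What THEOREM D's stack (n1011 F4/F5, D3b) provides is CLASS-level: `res_U κ = red_* X̃` and, for the
global obstruction classes, `M·y_g = g·X̃ − X̃` in `H¹(U, T)`.  This file bridges the two over the GLOBAL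
group (where `X'^U = 0`, `X' = E[M]`, holds — n1011's `h0`), for any topological group `G`, open normal
`U`, and representations whose orbit maps `g ↦ g·v` are continuous (true for the tree's `GaloisRep`s):

* `exists_cocycle_eq_and_restrict_eq` — from `res_U [k] = [xr]` (any cocycle `xr` on `U`, e.g. `red ∘ x̃`)
  a cocycle `k'` with `[k'] = [k]` and `k'|_U = xr` EXACTLY (subtract the principal cocycle of the
  witness; `exists_principal`);
* `conj_sub_apply_eq` — for a cocycle `k` on `G`: `g·k(g⁻¹ u g) − k(u) = u·k(g) − k(g)`;
* **`exists_cocycle_conj_sub_sub_eq_smul`** — from `k|_U = red ∘ x̃`, lifts `red (k̃ g) = k g`, a cocycle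
  `ỹ₀` with `M·[ỹ₀] = g·[x̃] − [x̃]`, `X'^U = 0`, `ker red ⊆ M·X` and `M·X' = 0`: a cocycle `ỹ` with
  `[ỹ] = [ỹ₀]` and `g·x̃(g⁻¹ u g) − x̃(u) − (u·k̃ g − k̃ g) = M·ỹ(u)` for all `u ∈ U` (the difference is a
  principal cocycle `∂b` with `red b ∈ X'^U = 0`, so `b ∈ M·X` is absorbed into `ỹ`).

HONEST LIMITS: TOOL lemmas (curve-free); close nothing; the recursion expressing `y_g` through the
Euler-system classes (memo §2) and the Mackey/universal-norm steps are not here; nothing is booked.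
References: J.-P. Serre, *Galois Cohomology* (1997), I §2 and §5.1; B. Mazur, K. Rubin, Mem. AMS 799
(2004), App. A.
-/

noncomputable section

set_option linter.dupNamespace false

open CategoryTheory Function Topology Filter
open Literature.NumberTheory.GaloisRepresentations
open Literature.NumberTheory.EllipticCurves (subgroupConj subgroupConj_apply_coe)
open Summit.BirchSwinnertonDyer.Rank1Residual.GaloisImage

universe u v

namespace Summit.BirchSwinnertonDyer.BirchSwinnertonDyer.Theorems.KimAtThreePortSharedC3

variable {R : Type u} [CommRing R] [TopologicalSpace R]
variable {G : Type v} [Group G] [TopologicalSpace G] [IsTopologicalGroup G]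
variable (X : TopRep.{v} R G) (U : Subgroup G) [U.Normal]

/-- The principal cocycle `g ↦ g·v − v` of a representation with continuous orbit maps EXISTS as a
continuous crossed homomorphism, and its class is `0` (an `∃`-statement, so that this file declares no
definition). [cite: SerreGaloisCohomology1997, I §5.1] -/
theorem exists_principal (hcont : ∀ v : X, Continuous fun g : G => X.ρ g v) (v : X) :
    ∃ π : contOneCocycles X, (∀ g : G, π.1 g = X.ρ g v - v) ∧ oneCocycleClass X π = 0 := by
  let π : contOneCocycles X :=
    ⟨⟨fun g => X.ρ g v - v, (hcont v).sub continuous_const⟩, fun g h => by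
      change X.ρ (g * h) v - v = X.ρ g v - v + X.ρ g (X.ρ h v - v)
      rw [ρ_mul_apply, map_sub]
      abel⟩
  exact ⟨π, fun _ => rfl, (oneCocycleClass_eq_zero_iff X _).2 ⟨v, fun _ => rfl⟩⟩

omit [IsTopologicalGroup G] [U.Normal] in
/-- Orbit maps of the restricted representation `X|_U` are continuous if those of `X` are.
[folklore] -/
theorem continuous_orbit_subgroupRep (hcont : ∀ v : X, Continuous fun g : G => X.ρ g v) (v : X) :
    Continuous fun u : U => (subgroupRep X U).ρ u v := by
  change Continuous fun u : U => X.ρ (u : G) v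
  exact (hcont v).comp continuous_subtype_val

omit [U.Normal] in
/-- **Exact restriction**: if `res_U [k] = [xr]` for cocycles `k` on `G` and `xr` on `U`, then some
cocycle `k'` with the same class as `k` restricts to `xr` on the nose (`k' = k − ∂v'` for the
witness `v'` of the class equality).  Used with `xr = red ∘ x̃`. [cite: SerreGaloisCohomology1997, I §2] -/
theorem exists_cocycle_eq_and_restrict_eq (hcont : ∀ v : X, Continuous fun g : G => X.ρ g v)
    (k : contOneCocycles X) (xr : contOneCocycles (subgroupRep X U))
    (h : resSubgroup X U 1 (oneCocycleClass X k) = oneCocycleClass _ xr) :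
    ∃ k' : contOneCocycles X, oneCocycleClass X k' = oneCocycleClass X k ∧
      ∀ u : U, k'.1 (u : G) = xr.1 u := by
  rw [resSubgroup_oneCocycleClass, ← sub_eq_zero, ← oneCocycleClass_sub, oneCocycleClass_eq_zero_iff] at h
  obtain ⟨v, hv⟩ := h
  obtain ⟨π, hπ, hπ0⟩ := exists_principal X hcont v
  refine ⟨k - π, ?_, fun u => ?_⟩
  · rw [oneCocycleClass_sub, hπ0, sub_zero]
  · have hu := hv u
    change k.1 (u : G) - xr.1 u = X.ρ (u : G) v - v at hu
    change k.1 (u : G) - π.1 (u : G) = xr.1 u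
    rw [hπ, ← hu, sub_sub_cancel]

omit [IsTopologicalGroup G] [U.Normal] in
/-- For a cocycle `k` on `G`: `g·k(g⁻¹ u g) − k(u) = u·k(g) − k(g)` (the conjugate of `k` differs from
`k` by the coboundary of `k(g)`). [folklore] -/
theorem conj_sub_apply_eq (k : contOneCocycles X) (g u : G) :
    X.ρ g (k.1 (g⁻¹ * u * g)) - k.1 u = X.ρ u (k.1 g) - k.1 g := by
  have e1 : k.1 (g⁻¹ * u * g) = k.1 g⁻¹ + X.ρ g⁻¹ (k.1 u + X.ρ u (k.1 g)) := by
    rw [mul_assoc, k.2 g⁻¹ (u * g), k.2 u g]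
  have e2 : k.1 g⁻¹ = -(X.ρ g⁻¹ (k.1 g)) := by
    have h := k.2 g⁻¹ g
    rw [inv_mul_cancel, contOneCocycles.apply_one] at h
    rw [eq_neg_iff_add_eq_zero, h]
  rw [e1, e2]
  simp only [map_add, map_neg, ρ_apply_ρ_inv_apply]
  abel

variable (X' : TopRep.{v} R G)

/-- **Exact obstruction identity** (memo §1): let `red : X ⟶ X'` with `ker red ⊆ M·X` (`hker`) and
`M·X' = 0` (`hM'`), `X'^U = 0` (`h0'`); let `k` be a cocycle on `G` (values in `X'`) and `x̃` a
cocycle on `U` with `k|_U = red ∘ x̃` (`hkx`), `k̃ g` a lift of `k(g)`, and `ỹ₀` a cocycle on `U` whose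
class satisfies `M·[ỹ₀] = g·[x̃] − [x̃]`.  Then some cocycle `ỹ` with `[ỹ] = [ỹ₀]` satisfies
`g·x̃(g⁻¹ u g) − x̃(u) − (u·k̃ g − k̃ g) = M·ỹ(u)` EXACTLY: the two sides differ by a principal cocycle
`∂b`; applying `red` (which kills the left side by `conj_sub_apply_eq` for `k`, and `M·ỹ₀` by `hM'`)
gives `red b ∈ X'^U = 0`, so `b = M·b'` and `ỹ = ỹ₀ + ∂b'`.  This is the input `hy` of Lemma C
(p469494) for the GLOBAL obstruction classes `y_g` (`M·y_g = (g−1)X̃`, n1011 D3b). [folklore] -/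
theorem exists_cocycle_conj_sub_sub_eq_smul (hcont : ∀ v : X, Continuous fun g : G => X.ρ g v)
    (red : X ⟶ X') (M : R) (hM' : ∀ v : X', M • v = 0)
    (hker : ∀ v : X, red.hom v = 0 → ∃ w : X, v = M • w)
    (h0' : ∀ v : X', (∀ u : U, X'.ρ (u : G) v = v) → v = 0)
    (k : contOneCocycles X') (x : contOneCocycles (subgroupRep X U))
    (hkx : ∀ u : U, k.1 (u : G) = red.hom (x.1 u))
    (g : G) (kl : X) (hkl : red.hom kl = k.1 g)
    (y₀ : contOneCocycles (subgroupRep X U))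
    (hy₀ : M • oneCocycleClass _ y₀ = conjMap X U g 1 (oneCocycleClass _ x) - oneCocycleClass _ x) :
    ∃ y : contOneCocycles (subgroupRep X U), oneCocycleClass _ y = oneCocycleClass _ y₀ ∧
      ∀ u : U, X.ρ g (x.1 (subgroupConj U g u)) - x.1 u - (X.ρ (u : G) kl - kl) = M • y.1 u := by
  have hcontU := continuous_orbit_subgroupRep X U hcont
  obtain ⟨πk, hπk, hπk0⟩ := exists_principal (subgroupRep X U) hcontU kl
  -- the cocycle `c = g⋆x − x − ∂(kl)` on `U`
  set c : contOneCocycles (subgroupRep X U) :=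
    contOneCocycles.pullback (subgroupConj U g) (conjRepHom X U g) x - x - πk with hc
  have hc_apply : ∀ u : U, c.1 u = X.ρ g (x.1 (subgroupConj U g u)) - x.1 u - (X.ρ (u : G) kl - kl) :=
    fun u => by
      change X.ρ g (x.1 (subgroupConj U g u)) - x.1 u - πk.1 u = _
      rw [hπk u]; rfl
  -- its class is `g·[x] − [x] = M·[y₀]`
  have hcls : oneCocycleClass _ c = M • oneCocycleClass _ y₀ := by
    rw [hc, oneCocycleClass_sub, oneCocycleClass_sub, ← conjMap_oneCocycleClass, hπk0, sub_zero, hy₀]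
  -- so `c − M•y₀ = ∂b`
  have hdiff : oneCocycleClass _ (c - M • y₀) = 0 := by
    rw [oneCocycleClass_sub, oneCocycleClass_smul, hcls, sub_self]
  rw [oneCocycleClass_eq_zero_iff] at hdiff
  obtain ⟨b, hb⟩ := hdiff
  -- `red b` is fixed by `U`, hence zero, hence `b = M • b'`
  have hredc : ∀ u : U, red.hom (c.1 u) = 0 := by
    intro u
    rw [hc_apply, map_sub, map_sub, map_sub, TopRep.hom_comm_apply red g, TopRep.hom_comm_apply red (u : G),
      hkl, ← hkx u, ← hkx (subgroupConj U g u), subgroupConj_apply_coe, conj_sub_apply_eq X' k g u, sub_self]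
  have hfix : ∀ u : U, X'.ρ (u : G) (red.hom b) = red.hom b := by
    intro u
    have h := hb u
    change c.1 u - M • y₀.1 u = X.ρ (u : G) b - b at h
    have h2 := congrArg red.hom h
    rw [map_sub, hredc u, map_smul, hM', sub_zero, map_sub, TopRep.hom_comm_apply red (u : G)] at h2
    exact (sub_eq_zero.mp h2.symm)
  obtain ⟨b', hb'⟩ := hker b (h0' _ hfix)
  obtain ⟨πb, hπb, hπb0⟩ := exists_principal (subgroupRep X U) hcontU b'
  refine ⟨y₀ + πb, ?_, fun u => ?_⟩
  · rw [oneCocycleClass_add, hπb0, add_zero]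
  · have h := hb u
    change c.1 u - M • y₀.1 u = X.ρ (u : G) b - b at h
    rw [sub_eq_iff_eq_add'] at h
    rw [← hc_apply u, h, hb']
    change M • y₀.1 u + (X.ρ (u : G) (M • b') - M • b') = M • (y₀.1 u + πb.1 u)
    rw [hπb u, map_smul, smul_add]
    change _ = M • y₀.1 u + M • (X.ρ (u : G) b' - b')
    rw [smul_sub]

end Summit.BirchSwinnertonDyer.BirchSwinnertonDyer.Theorems.KimAtThreePortSharedC3

end
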